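import Summits.QuantumFields.YangMills.Theorems.BalabanUVNodesC44IterMhGaugeCovariance
import HarnessLib

/-!
# KERNEL ANCHOR FOR Q-37: A GAUGE ROTATION AT ONE FINE SITE PASSES THROUGH THE `k`-FOLD FRAME-FREE (0.4) AVERAGING **UNDILUTED** — exactly, for every `k`
# (★ PT-B g9's located chart∕scale finding on K0ᴬ row (c), nodeO STATUS l.5767; ★★★ director-ym №592 (3)(i): «the exact gauge-mode identity as a STAGED kernel anchor»)

Cell `pub-ymgap` ∕ `ym-nodeO-ideate`, porter lineage `ymgap-nodeO-port-PTB-1` (gen 9).  STAGED at HOME; filed ONLY on ◆ CRIT-1's GO (`--kind proof --supports stmt-QuantumFields-27238 --as helper`); count-neutral.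
[B7] = [Balaban1985Averaging]; [RG1] = [Balaban1987RG1]; [B11] = [Balaban1985Variational].

THE POINT (memo `KLC-CHART-SCALE-g9.md`).  Print's `C` of [B11] (44) is [B7]'s FRAMED remainder (double-bar chart (89)∕(121): block frames `wframe` divided out, so a gauge rotation at a block
root is INVISIBLE to `Q(V₀, A)`; lit ✓`B7Prop3GeneralLinear.Qcov`∕✓`B7Prop5GeneralInduction.CCovIter`, (157) dilute with `C₃η^d`).  The record's `COfRecord`∕`CslOfRecord` (def-Y 3e′∕3f′) is the FRAME-FREE
log-chart of the holomorphic (0.4) averaging `iterMh`.  This file proves, EXACTLY and for every `k`, what the frame-free averaging does to the simplest non-dilute configuration: the pure gauge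
`b ↦ G(b₋)·G(b₊)⁻¹` of an `SL(N, ℂ)`-valued site map `G` (for `G` supported at ONE fine site `x₀` this field differs from `1` on at most the `2d` bonds at `x₀`) averages to the COARSE pure gauge
`c ↦ G(ctr_k c₋)·G(ctr_k c₊)⁻¹` with `ctr_k = embIter k` — i.e. the rotation `g = G(x₀)` re-appears at FULL AMPLITUDE on every level-`k` bond whose `k`-fold centre is `x₀` (and the field
is invisible iff `x₀` is not a `k`-fold centre).  No `η^d`, no `L^{-k}`: the frame-free chart sees centre gauge modes undiluted; print's framed chart does not see them at all.  This is the
`O(1)`-amplitude mode behind the memo's bound `g₀ ≥ c_N·η_k∕(4d)` for the on-cone entry letter `hg` of ✓`C44IterMhCone.kernelLetterC_of_cone` versus the window's `O(η_k^d)`.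

WHAT THIS FILE PROVES (0 def; from ✓`iterMh_gaugeSL` (F4′-1) + `adjugate 1 = 1` + lit ✓`BlockAveragingEMLAnalyticMean.eml_one`):
§1 `stepMh_const_one`, `holMh_const_one`, `avgMh_const_one`, ★ `iterMh_const_one` — the unit field is a fixed point of the holomorphic averaging at every level (no guard needed; general-`N`
   editions of ▶ PT-A's `N = 2` ✓`BalabanUVNodesPortS1JacDomTower.holMh_one`∕`avgMh_one`∕`iterMh_one`, which are stated on `MatA 2` and are not importable at general `N`).
§2 ★★ `iterMh_pureGaugeSL` — `Ū^k_h(b ↦ G(b₋)G(b₊)⁻¹) = (c ↦ G(embIter k c₋)·G(embIter k c₊)⁻¹)` for every `SL(N,ℂ)` site map `G`, every `k`;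
   ★★★ `iterMh_siteGaugeSL` — for `G := 1` off `x₀`, `G(x₀) = g` (`det g = 1`): `Ū^k_h(…)(c) = [g if embIter k c₋ = x₀ else 1]·[g if embIter k c₊ = x₀ else 1]⁻¹`;
   `iterMh_siteGaugeSL_of_src` (`= g` when `embIter k c₋ = x₀ ≠ embIter k c₊`: FULL amplitude), `iterMh_siteGaugeSL_of_not_mem` (`= 1` on every `c` with neither centre at `x₀`: invisible).
HONEST FRAMING.  An exact algebraic identity (gauge covariance of (0.4) read on pure gauges); it asserts NO estimate and refutes NO theorem of the tree or of print — it LOCATES the chart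
discrepancy (frame-free vs framed) that makes [B7] (157)'s `C₃η^d` inapplicable «by name» to `CslOfRecord`; the second-order (commutator) consequence for `D C^{𝔰𝔩}` is the memo's pen-and-paper
§3, not this file.  (KL-C)∕(KL-N)∕(3.133) at the record OPEN; K0ᴬ ⟨stmt-QuantumFields-27238⟩ NOT closed; K0ᴬ∕K1ᴬ∕K3ᴬ 0∕3; NODE O 0∕1; COUNT 8∕28 · K 1∕4 UNMOVED; finite `𝕋⁴_{L^K}` at
fixed ε — NOT continuum ∕ ℝ⁴ ∕ OS; **the Yang–Mills mass gap (Clay) is NOT proved by any of this.**  No `sorry`, `instance`, `notation`, `set_option`; standard axioms.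
-/

noncomputable section

open scoped Matrix Matrix.Norms.L2Operator

namespace Summit.QuantumFields.YangMills.Theorems.C44IterMh

open Literature.MathematicalPhysics.QuantumFieldTheory.Balaban1983to89
open T4Continuum BlockAveraging B15DeterminingSets
open B15AveragingHolomorphic (stepMh holMh holMh_nil holMh_cons loopMh axialMh corrMh avgMh iterMh iterMh_zero iterMh_succ)
open ExpMeanLog (eml)
open BlockAveragingEMLAnalyticMean (eml_one)

/-! ## §1  The unit field is fixed by the holomorphic (0.4) averaging at every level -/

section Unit

variable {P : Params} {j : ℕ} {N : ℕ}

/-- Every holomorphic step of the unit field is `1` (`adj 1 = 1`). [cite: Balaban1987RG1, (0.4) p.253 (bookkeeping)] -/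
theorem stepMh_const_one (s : LStep P j) : stepMh (fun _ : PBond P j => (1 : Matrix (Fin N) (Fin N) ℂ)) s = 1 := by
  unfold stepMh
  split_ifs
  · rfl
  · exact Matrix.adjugate_one

/-- Every holomorphic walk product of the unit field is `1`. [cite: Balaban1987RG1, (0.4) p.253 (bookkeeping)] -/
theorem holMh_const_one : ∀ γ : List (LStep P j), holMh (fun _ : PBond P j => (1 : Matrix (Fin N) (Fin N) ℂ)) γ = 1
  | [] => holMh_nil _
  | s :: γ => by rw [holMh_cons, stepMh_const_one, holMh_const_one γ, one_mul]

/-- The one-step holomorphic average of the unit field is the unit field (`exp[mean log 1] = 1`, lit ✓`eml_one`). [cite: Balaban1987RG1, (0.4) p.253; Balaban1985Averaging, (42) p.23] -/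
theorem avgMh_const_one : avgMh (fun _ : PBond P j => (1 : Matrix (Fin N) (Fin N) ℂ)) = fun _ => 1 := by
  funext c
  show corrMh _ c * axialMh _ c = 1
  have hloop : (fun i : Idx P => loopMh (fun _ : PBond P j => (1 : Matrix (Fin N) (Fin N) ℂ)) c i) = 1 := funext fun i => holMh_const_one _
  rw [corrMh, hloop, eml_one, axialMh, holMh_const_one, one_mul]

/-- ★ **The unit field is a fixed point of the `k`-fold holomorphic averaging** (no guard; general-`N` form of ▶ PT-A's ✓`BalabanUVNodesPortS1JacDomTower.iterMh_one`, which is the `MatA 2`,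
`Pi.one` instance — ◆ CRIT-1 g39 rider R-n). [cite: Balaban1987RG1, (0.21) p.256, (0.4) p.253] -/
theorem iterMh_const_one : ∀ k : ℕ, iterMh k (fun _ : PBond P 0 => (1 : Matrix (Fin N) (Fin N) ℂ)) = fun _ => 1
  | 0 => rfl
  | k + 1 => by rw [iterMh_succ, iterMh_const_one k]; exact avgMh_const_one

end Unit

/-! ## §2  A pure gauge passes through the frame-free averaging as the COARSE pure gauge read at the `k`-fold centres — undiluted -/

section Gauge

variable {P : Params} {N : ℕ}

/-- ★★ **PURE GAUGES AVERAGE TO PURE GAUGES AT THE CENTRES, EXACTLY**: for every `SL(N, ℂ)`-valued site map `G` on the finest lattice and every `k`,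
`Ū^k_h(b ↦ G(b₋)·G(b₊)⁻¹)(c) = G(embIter k c₋)·G(embIter k c₊)⁻¹` (✓`iterMh_gaugeSL` at `V = 1` + `iterMh_const_one`). [cite: Balaban1985Averaging, (11) p.19; Balaban1987RG1, (0.21) p.256] -/
theorem iterMh_pureGaugeSL (G : Site P 0 → Matrix (Fin N) (Fin N) ℂ) (hG : ∀ x, (G x).det = 1) (k : ℕ) :
    iterMh k (fun b : PBond P 0 => G b.src * (G b.tgt)⁻¹) = fun c => G (embIter k c.src) * (G (embIter k c.tgt))⁻¹ := by
  have h := iterMh_gaugeSL G hG (fun _ : PBond P 0 => (1 : Matrix (Fin N) (Fin N) ℂ)) k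
  simp only [mul_one] at h
  rw [h, iterMh_const_one k]
  simp only [mul_one]

open Classical in
/-- ★★★ **A GAUGE ROTATION `g ∈ SL(N, ℂ)` AT ONE FINE SITE `x₀` IS SEEN BY THE `k`-FOLD FRAME-FREE AVERAGE AT FULL AMPLITUDE**: the fine field `b ↦ G(b₋)G(b₊)⁻¹`, `G = 1` off `x₀`, `G(x₀) = g`
(it differs from `1` on at most the `2d` bonds at `x₀`) averages to `c ↦ [g if embIter k c₋ = x₀ else 1]·[g if embIter k c₊ = x₀ else 1]⁻¹` — NO factor `η^d`, NO factor `L^{−k}`.  In print's FRAMED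
chart ([B7] (89)∕(121), [B11] p.281 (19)–(21)) the same configuration is gauge-equivalent to `1` and carries `Q(V₀, ·) = 0`. [cite: Balaban1985Averaging, (11) p.19, (89) p.31, (121) p.36; Balaban1987RG1, (0.21) p.256; Balaban1985Variational, (19)–(21) p.281] -/
theorem iterMh_siteGaugeSL (x₀ : Site P 0) (g : Matrix (Fin N) (Fin N) ℂ) (hg : g.det = 1) (k : ℕ) (c : PBond P k) :
    iterMh k (fun b : PBond P 0 => (if b.src = x₀ then g else 1) * (if b.tgt = x₀ then g else 1)⁻¹) c =
      (if embIter k c.src = x₀ then g else 1) * (if embIter k c.tgt = x₀ then g else 1)⁻¹ := by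
  have hG : ∀ x : Site P 0, ((fun x => if x = x₀ then g else (1 : Matrix (Fin N) (Fin N) ℂ)) x).det = 1 := fun x => by
    simp only
    split_ifs
    · exact hg
    · exact Matrix.det_one
  exact congrFun (iterMh_pureGaugeSL (fun x => if x = x₀ then g else 1) hG k) c

open Classical in
/-- FULL AMPLITUDE: on a level-`k` bond whose source has `k`-fold centre `x₀` and whose target has not, the average IS `g`. [cite: Balaban1985Averaging, (11) p.19; Balaban1987RG1, (0.21) p.256] -/
theorem iterMh_siteGaugeSL_of_src (x₀ : Site P 0) (g : Matrix (Fin N) (Fin N) ℂ) (hg : g.det = 1) (k : ℕ) (c : PBond P k)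
    (hsrc : embIter k c.src = x₀) (htgt : embIter k c.tgt ≠ x₀) :
    iterMh k (fun b : PBond P 0 => (if b.src = x₀ then g else 1) * (if b.tgt = x₀ then g else 1)⁻¹) c = g := by
  rw [iterMh_siteGaugeSL x₀ g hg k c, if_pos hsrc, if_neg htgt, inv_one, mul_one]

open Classical in
/-- INVISIBILITY OFF THE CENTRES: on every level-`k` bond neither of whose endpoints has `k`-fold centre `x₀` the average is `1` (in particular the field is invisible at level `k` iff `x₀` is
not a `k`-fold centre). [cite: Balaban1985Averaging, (11) p.19; Balaban1987RG1, (0.21) p.256] -/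
theorem iterMh_siteGaugeSL_of_not_mem (x₀ : Site P 0) (g : Matrix (Fin N) (Fin N) ℂ) (hg : g.det = 1) (k : ℕ) (c : PBond P k)
    (hsrc : embIter k c.src ≠ x₀) (htgt : embIter k c.tgt ≠ x₀) :
    iterMh k (fun b : PBond P 0 => (if b.src = x₀ then g else 1) * (if b.tgt = x₀ then g else 1)⁻¹) c = 1 := by
  rw [iterMh_siteGaugeSL x₀ g hg k c, if_neg hsrc, if_neg htgt, inv_one, mul_one]

end Gauge

end Summit.QuantumFields.YangMills.Theorems.C44IterMh

end
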